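import Mathlib
import HarnessLib
import Literature.Analysis.SpecialFunctions.BesselKLaplaceEndpoint
import Summits.AtomisticToContinuum.Crystallization.Theorems.HolmgrenBoyleLindHalfSpaceUniqueContinuationShellPeelingTail

/-!
# Route `HolmgrenBoyleLind`: Lennard-Jones force fields of separated sources, part 18 —
SHELL PEELING: an identically vanishing mode sum has vanishing shell sums of fibres

Support file for the crux item stmt-AtomisticToContinuum-6075 (`HalfSpaceUniqueContinuation`, line
`registered`, layered core, THICK-CLASS PEELING; infrastructure written by a stub-worker of lead c3).
ABSTRACT SETTING (no geometry). Frequencies `k : K` (countable) with shell radii `ρ k ≥ 0`,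
`ρ k = 0 ↔ k = k₀`, finite shells, `∑ₖ e^{-ε ρ k} < ∞`; unimodular weights `ψ k` (= `e_k(b₀)`);
sources `q : R` (countable), heights `y q ≥ 0` with window count `N`, mode weights `θ k q`,
`‖θ k q‖ ≤ 1`. The mode of frequency `k` at depth `X` is `M k X = ∑_q θ k q · 𝔪ₖ(X + y q)` with
`𝔪_{k₀}(t) = c₀ · (−π (t⁻⁵/3 − t⁻¹¹/6))` and, for `k ≠ k₀`, `r = ρ k`,
`𝔪ₖ(t) = a(r) t⁻² J_{ν₁}(2πr, t) + b(r) t⁻⁵ J_{ν₂}(2πr, t)`, `J_ν(c,t) = ∫ e^{νu − c t cosh u} du`,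
with SHELL-CONSTANT real coefficients `a r ≠ 0`, `|a r|, |b r| ≤ A e^{r}` (vertical component:
`ν = (3,6)`, `a r = −(π/6)(πr)³`, `b r = (π/720)(πr)⁶`, `c₀ = 1`; horizontal components after
dividing by `−πi‖c‖`: `ν = (2,5)`, `a r = (π/6)(πr)² r`, `b r = −(π/720)(πr)⁵ r`, `c₀ = 0`).

* `hbl_peel_step` — THE INDUCTION STEP: if the mode sum vanishes for `X ≥ T`, the zero mode
  vanishes there, and every shell of radius `< ρ k` has vanishing `ψ`-weighted fibre sums, then so
  does the shell `S = {ρ = ρ k}`: the lower shells have vanishing combined modes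
  (`hbl_peel_shellSum_eq`, `hbl_tsum_eq_zero_of_fibres` of part 18a), so `S` carries the whole
  finite part below `ρ k`, which is `O(e^{-κX})` with `κ > 2π ρ k` (`hbl_peel_tail_decay`); with the
  normalised combined weights `Θ = |S|⁻¹ ∑_{k' ∈ S} ψ k' θ k'` the shell equals
  `|S| (a I₁[Θ] + b I₂[Θ])` (`hbl_hasSum_shellProfile`), and the decay form of the one-shell lemma
  `hbl_shell_fibres_eq_zero_of_laplace_decay` (signed pair `eqOn_zero_of_laplace_exp_decay_signedPair`
  + endpoint domination `besselLaplaceMeasure_le_mul_near_endpoint`, `a ≠ 0`) kills the fibres of `Θ`;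
* **`hbl_shellSums_eq_zero_of_modeSum_eq_zero'`** (+ registered `∀`-form without the prime) — if
  `∑ₖ ψ k · M k X = 0` for every `X > X₀` then (i) if `c₀ ≠ 0`, every height fibre
  `∑_{y q = η} θ k₀ q` of the zero mode vanishes, and (ii) for every shell radius `r = ρ k > 0` and
  height `η`, `∑_{ρ k' = r} ψ k' ∑_{y q = η} θ k' q = 0`. Proof (peeling by increasing radius, no
  Duffin–Schaeffer), with `t₀ = X₀`, `T = X₀ + 3`: the zero mode is minus the tail beyond radius
  `0`, `O(e^{-κX})` with `κ > 0`, so `hbl_peel_zeroMode` (part 18b: Pólya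
  `ae_eq_zero_of_laplace_exp_decay`, then `generalDirichlet_hasSum_zero_of_eqOn_Ioo`) kills its
  fibres and the mode; then strong induction on `#{k' | ρ k' < ρ k}` with `hbl_peel_step`.
All `[folklore]`; nothing here closes an item.
-/

noncomputable section

namespace Summit.AtomisticToContinuum.Crystallization.Theorems.HolmgrenBoyleLind

open scoped BigOperators Topology
open MeasureTheory Filter Set Literature.Analysis.SpecialFunctions

section Peel

variable {K R : Type*} [Countable R] [DecidableEq K] {k₀ : K} {ρ : K → ℝ} {ψ : K → ℂ}
  {θ : K → R → ℂ} {y : R → ℝ} {N : ℕ} {ν₁ ν₂ c₀ : ℝ} {a b : ℝ → ℝ} {A t₀ T : ℝ}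
  {M : K → ℝ → ℂ}

omit [Countable R] [DecidableEq K] in
/-- **A shell sum is a single layer sum with the combined weights** (bookkeeping). If on the finite
set `S` of frequencies every mode at depth `X` is the layer sum of one and the same profile,
`M k X = ∑_q θ k q F(y q)`, absolutely convergent, then
`∑_{k ∈ S} ψ k M k X = ∑_q (∑_{k ∈ S} ψ k θ k q) F(y q)`, absolutely convergent
(`Summable.tsum_finsetSum`); in particular it vanishes as soon as the `ψ`-weighted fibre sums
`∑_{k ∈ S} ψ k ∑_{y q = η} θ k q` do (`hbl_tsum_eq_zero_of_fibres`). [folklore] -/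
theorem hbl_peel_shellSum_eq (hy : ∀ q, 0 ≤ y q)
    (hN : ∀ j : ℕ, {q : R | (j : ℝ) ≤ y q ∧ y q ≤ j + 1}.encard ≤ N) (S : Finset K) (F : ℝ → ℂ)
    {X : ℝ} (hF : ∀ k ∈ S, Summable fun q => θ k q * F (y q))
    (hMk : ∀ k ∈ S, M k X = ∑' q, θ k q * F (y q)) :
    (Summable fun q => (∑ k ∈ S, ψ k * θ k q) * F (y q)) ∧
      ∑ k ∈ S, ψ k * M k X = ∑' q, (∑ k ∈ S, ψ k * θ k q) * F (y q) ∧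
      ((∀ η : ℝ, ∑ k ∈ S,
          ψ k * ∑ q ∈ (hbl_shell_heights_finite hN hy η).toFinset with y q = η, θ k q = 0) →
        ∑ k ∈ S, ψ k * M k X = 0) := by
  have hdist : ∀ q, ∑ k ∈ S, ψ k * (θ k q * F (y q)) = (∑ k ∈ S, ψ k * θ k q) * F (y q) :=
    fun q => by rw [Finset.sum_mul]; simp only [mul_assoc]
  have hsum : Summable fun q => (∑ k ∈ S, ψ k * θ k q) * F (y q) :=
    (summable_sum fun k hk => (hF k hk).mul_left (ψ k)).congr hdist
  have heq : ∑ k ∈ S, ψ k * M k X = ∑' q, (∑ k ∈ S, ψ k * θ k q) * F (y q) :=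
    calc ∑ k ∈ S, ψ k * M k X = ∑ k ∈ S, ∑' q, ψ k * (θ k q * F (y q)) :=
          Finset.sum_congr rfl fun k hk => by rw [hMk k hk, tsum_mul_left]
      _ = ∑' q, ∑ k ∈ S, ψ k * (θ k q * F (y q)) :=
          (Summable.tsum_finsetSum fun k hk => (hF k hk).mul_left (ψ k)).symm
      _ = _ := tsum_congr hdist
  refine ⟨hsum, heq, fun hfib => heq.trans (hbl_tsum_eq_zero_of_fibres
    (hbl_shell_heights_finite hN hy) F hsum fun η => ?_)⟩
  rw [Finset.sum_comm]
  simpa only [Finset.mul_sum] using hfib η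

/-- **Peeling one shell (the induction step).** Assume the mode sum vanishes identically, the
zero mode vanishes for `X ≥ T`, and every shell of radius `< ρ k` (`k ≠ k₀`) has vanishing
`ψ`-weighted fibre sums. Then so does the shell of radius `r = ρ k`: the lower shells have
vanishing combined modes (`hbl_peel_shellSum_eq`, `hbl_tsum_eq_zero_of_fibres`), so the shell
`S = {ρ = r}` carries the whole finite part below `r`, which is `O(e^{-κX})` with `κ > 2πr`
(`hbl_peel_tail_decay`); with the normalised combined weights `Θ = (∑_{k' ∈ S} ψ k' θ k')/|S|`
the shell is `|S| (a(r) I₁[Θ] + b(r) I₂[Θ])` (`hbl_hasSum_shellProfile`), and the decay form of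
the one-shell lemma (`hbl_shell_fibres_eq_zero_of_laplace_decay`, endpoint domination
`besselLaplaceMeasure_le_mul_near_endpoint`, `a(r) ≠ 0`) kills the fibres of `Θ`. [folklore] -/
theorem hbl_peel_step (hρ0 : ρ k₀ = 0) (hρ : ∀ k, k ≠ k₀ → 0 < ρ k)
    (hfin : ∀ C : ℝ, {k : K | ρ k ≤ C}.Finite)
    (hexp : ∀ ε : ℝ, 0 < ε → Summable fun k : K => Real.exp (-(ε * ρ k)))
    (hψ : ∀ k, ‖ψ k‖ = 1) (hθ : ∀ k q, ‖θ k q‖ ≤ 1) (hy : ∀ q, 0 ≤ y q)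
    (hN : ∀ j : ℕ, {q : R | (j : ℝ) ≤ y q ∧ y q ≤ j + 1}.encard ≤ N)
    (ha : ∀ r, 0 < r → a r ≠ 0)
    (hab : ∀ r, 0 < r → |a r| ≤ A * Real.exp r ∧ |b r| ≤ A * Real.exp r)
    (ht₀ : 0 < t₀) (hT : t₀ + 3 ≤ T)
    (hM : ∀ (k : K) (X : ℝ), M k X = ∑' q, θ k q *
      (if k = k₀ then
        ((c₀ * (-(Real.pi * ((X + y q)⁻¹ ^ 5 / 3 - (X + y q)⁻¹ ^ 11 / 6))) : ℝ) : ℂ)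
      else
        ((a (ρ k) * (((X + y q) ^ (-(2 : ℝ)) : ℝ) *
              ∫ u : ℝ, Real.exp (ν₁ * u - 2 * Real.pi * ρ k * (X + y q) * Real.cosh u)) +
          b (ρ k) * (((X + y q) ^ (-(5 : ℝ)) : ℝ) *
              ∫ u : ℝ, Real.exp (ν₂ * u - 2 * Real.pi * ρ k * (X + y q) * Real.cosh u)) :
          ℝ) : ℂ)))
    (hM0 : ∀ X : ℝ, T ≤ X → HasSum (fun k : K => ψ k * M k X) 0)
    (hZ : ∀ X : ℝ, T ≤ X → M k₀ X = 0) {k : K} (hk : k ≠ k₀)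
    (ih : ∀ k' : K, k' ≠ k₀ → ρ k' < ρ k → ∀ η : ℝ,
      ∑ k'' ∈ (hfin (ρ k')).toFinset with ρ k'' = ρ k',
        ψ k'' * ∑ q ∈ (hbl_shell_heights_finite hN hy η).toFinset with y q = η, θ k'' q = 0)
    (η : ℝ) :
    ∑ k' ∈ (hfin (ρ k)).toFinset with ρ k' = ρ k,
      ψ k' * ∑ q ∈ (hbl_shell_heights_finite hN hy η).toFinset with y q = η, θ k' q = 0 := by
  have hr : 0 < ρ k := hρ k hk
  have hc : 0 < 2 * Real.pi * ρ k := by positivity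
  set F := (hfin (ρ k)).toFinset with hF
  set S := F.filter (fun k' => ρ k' = ρ k) with hSdef
  have hkS : k ∈ S := Finset.mem_filter.2 ⟨(hfin _).mem_toFinset.2 (le_refl (ρ k)), rfl⟩
  have hn0 : 0 < S.card := Finset.card_pos.2 ⟨k, hkS⟩
  have hn : 0 < (S.card : ℝ) := Nat.cast_pos.2 hn0
  have hSρ : ∀ k' ∈ S, ρ k' = ρ k := fun k' hk' => (Finset.mem_filter.1 hk').2
  -- a frequency in the shell of some `k₁ ≠ k₀` is not `k₀`
  have hSk0 : ∀ {k₁ k'' : K}, k₁ ≠ k₀ →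
      k'' ∈ ((hfin (ρ k₁)).toFinset.filter fun k' => ρ k' = ρ k₁) → k'' ≠ k₀ := by
    intro k₁ k'' hk₁ hk'' h
    have h1 : ρ k'' = ρ k₁ := (Finset.mem_filter.1 hk'').2
    rw [h, hρ0] at h1
    exact (hρ k₁ hk₁).ne' h1.symm
  -- (1) a lower shell has vanishing combined mode
  have hshell0 : ∀ k₁, k₁ ≠ k₀ → ρ k₁ < ρ k → ∀ X, T ≤ X →
      ∑ k'' ∈ (hfin (ρ k₁)).toFinset with ρ k'' = ρ k₁, ψ k'' * M k'' X = 0 := by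
    intro k₁ hk₁ hlt X hX
    have hXt : t₀ < X := by linarith
    exact (hbl_peel_shellSum_eq (ψ := ψ) (M := M) hy hN
      ((hfin (ρ k₁)).toFinset.filter fun k'' => ρ k'' = ρ k₁)
      (fun s => ((a (ρ k₁) * (((X + s) ^ (-(2 : ℝ)) : ℝ) *
          ∫ u : ℝ, Real.exp (ν₁ * u - 2 * Real.pi * ρ k₁ * (X + s) * Real.cosh u)) +
        b (ρ k₁) * (((X + s) ^ (-(5 : ℝ)) : ℝ) *
          ∫ u : ℝ, Real.exp (ν₂ * u - 2 * Real.pi * ρ k₁ * (X + s) * Real.cosh u)) : ℝ) : ℂ))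
      (fun k'' _ => (hbl_hasSum_shellProfile (hθ k'') hy hN ν₁ ν₂ (a (ρ k₁)) (b (ρ k₁))
        (hρ k₁ hk₁) ht₀ hXt).summable)
      (fun k'' hk'' => by
        rw [hM k'' X]
        simp only [if_neg (hSk0 hk₁ hk''), (Finset.mem_filter.1 hk'').2])).2.2 (ih k₁ hk₁ hlt)
  -- (2) the finite part below `ρ k` reduces to the shell `S`
  have hFS : ∀ X, T ≤ X → ∑ k' ∈ F, ψ k' * M k' X = ∑ k' ∈ S, ψ k' * M k' X := by
    intro X hX
    rw [← Finset.sum_filter_add_sum_filter_not F (fun k' => ρ k' = ρ k), add_eq_left,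
      ← Finset.sum_fiberwise_of_maps_to (g := ρ)
        (fun k' hk' => Finset.mem_image_of_mem ρ hk')]
    refine Finset.sum_eq_zero fun r' hr' => ?_
    obtain ⟨k₁, hk₁, rfl⟩ := Finset.mem_image.1 hr'
    have hk₁F : ρ k₁ ≤ ρ k := (hfin _).mem_toFinset.1 (Finset.mem_filter.1 hk₁).1
    have hk₁ne : ρ k₁ ≠ ρ k := (Finset.mem_filter.1 hk₁).2
    have hlt : ρ k₁ < ρ k := lt_of_le_of_ne hk₁F hk₁ne
    by_cases hk₁0 : k₁ = k₀
    · refine Finset.sum_eq_zero fun k' hk' => ?_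
      have hρk' : ρ k' = ρ k₁ := (Finset.mem_filter.1 hk').2
      have hk'0 : k' = k₀ := by
        by_contra hne
        have h := hρ k' hne
        rw [hρk', hk₁0, hρ0] at h
        exact lt_irrefl _ h
      rw [hk'0, hZ X hX, mul_zero]
    · have hset : ((F.filter fun k' => ¬ρ k' = ρ k).filter fun k' => ρ k' = ρ k₁) =
          (hfin (ρ k₁)).toFinset.filter fun k'' => ρ k'' = ρ k₁ := by
        ext k'
        simp only [Finset.mem_filter, Set.Finite.mem_toFinset, Set.mem_setOf_eq, hF]
        constructor
        · rintro ⟨-, h⟩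
          exact ⟨h.le, h⟩
        · rintro ⟨-, h⟩
          exact ⟨⟨h.le.trans hlt.le, fun h' => hk₁ne (h.symm.trans h')⟩, h⟩
      rw [hset]
      exact hshell0 k₁ hk₁0 hlt X hX
  -- (3) decay of the shell
  obtain ⟨κ, C, hκ, hdec⟩ := hbl_peel_tail_decay hρ0 hfin hexp hψ hθ hy hN hab ht₀ hT hM hM0 hr.le
  -- (4) the combined, normalised weights
  set Θ : R → ℂ := fun q => (∑ k' ∈ S, ψ k' * θ k' q) / (S.card : ℂ) with hΘ
  have hΘ1 : ∀ q, ‖Θ q‖ ≤ 1 := fun q => by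
    simp only [hΘ]
    rw [norm_div, Complex.norm_natCast, div_le_one hn]
    refine (norm_sum_le _ _).trans ?_
    calc ∑ k' ∈ S, ‖ψ k' * θ k' q‖ ≤ ∑ k' ∈ S, (1 : ℝ) := Finset.sum_le_sum fun k' _ => by
            rw [norm_mul, hψ, one_mul]; exact hθ k' q
      _ = S.card := by simp
  have hΘS : ∀ q, ∑ k' ∈ S, ψ k' * θ k' q = (S.card : ℂ) * Θ q := fun q => by
    simp only [hΘ]
    rw [mul_div_cancel₀ _ (Nat.cast_ne_zero.2 hn0.ne')]
  -- (5) the shell sum as `|S| (a I₁[Θ] + b I₂[Θ])`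
  have hval : ∀ X, T ≤ X → ∑ k' ∈ S, ψ k' * M k' X = (S.card : ℂ) *
      ((a (ρ k) : ℂ) * (∫ l, Complex.exp (-((l * (X - t₀) : ℝ) : ℂ)) *
          (∑' q, Θ q * Complex.exp (-((y q : ℂ) * ((max l (2 * Real.pi * ρ k) : ℝ) : ℂ))))
            ∂(besselLaplaceMeasure ν₁ 2 (2 * Real.pi * ρ k) t₀)) +
        (b (ρ k) : ℂ) * (∫ l, Complex.exp (-((l * (X - t₀) : ℝ) : ℂ)) *
          (∑' q, Θ q * Complex.exp (-((y q : ℂ) * ((max l (2 * Real.pi * ρ k) : ℝ) : ℂ))))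
            ∂(besselLaplaceMeasure ν₂ 5 (2 * Real.pi * ρ k) t₀))) := by
    intro X hX
    have hXt : t₀ < X := by linarith
    obtain ⟨-, heq, -⟩ := hbl_peel_shellSum_eq (ψ := ψ) (M := M) hy hN S
      (fun s => ((a (ρ k) * (((X + s) ^ (-(2 : ℝ)) : ℝ) *
          ∫ u : ℝ, Real.exp (ν₁ * u - 2 * Real.pi * ρ k * (X + s) * Real.cosh u)) +
        b (ρ k) * (((X + s) ^ (-(5 : ℝ)) : ℝ) *
          ∫ u : ℝ, Real.exp (ν₂ * u - 2 * Real.pi * ρ k * (X + s) * Real.cosh u)) : ℝ) : ℂ))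
      (fun k' _ => (hbl_hasSum_shellProfile (hθ k') hy hN ν₁ ν₂ (a (ρ k)) (b (ρ k)) hr ht₀
        hXt).summable)
      (fun k' hk' => by
        rw [hM k' X]
        simp only [if_neg (hSk0 hk hk'), hSρ k' hk'])
    rw [heq, ← (hbl_hasSum_shellProfile hΘ1 hy hN ν₁ ν₂ (a (ρ k)) (b (ρ k)) hr ht₀ hXt).tsum_eq,
      ← tsum_mul_left]
    exact tsum_congr fun q => by rw [hΘS q, mul_assoc]
  -- (6) decay form of the one-shell lemma for `Θ`
  have hfibΘ : ∀ η' : ℝ,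
      ∑ q ∈ (hbl_shell_heights_finite hN hy η').toFinset with y q = η', Θ q = 0 := by
    refine hbl_shell_fibres_eq_zero_of_laplace_decay hΘ1 hy hN ν₁ ν₂ (p₁ := 2) (p₂ := 5)
      two_pos (by norm_num) hc ht₀
      (fun κ' hκ' => besselLaplaceMeasure_le_mul_near_endpoint ν₁ ν₂ two_pos (by norm_num) hc
        ht₀ hκ')
      (α := (a (ρ k) : ℂ)) (β := -(b (ρ k) : ℂ)) (Complex.ofReal_ne_zero.2 (ha _ hr))
      (C := C / S.card) (X₁ := T) hκ fun X hX => ?_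
    rw [neg_mul, sub_neg_eq_add]
    have h := hdec X hX
    rw [hFS X hX, hval X hX, norm_mul, Complex.norm_natCast] at h
    rw [div_mul_eq_mul_div, le_div_iff₀ hn, mul_comm]
    exact h
  -- (7) back to the `ψ`-weighted fibre sums of the shell
  calc ∑ k' ∈ S, ψ k' * ∑ q ∈ (hbl_shell_heights_finite hN hy η).toFinset with y q = η, θ k' q
      = ∑ q ∈ (hbl_shell_heights_finite hN hy η).toFinset with y q = η,
          ∑ k' ∈ S, ψ k' * θ k' q := by
        simp only [Finset.mul_sum]
        exact Finset.sum_comm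
    _ = (S.card : ℂ) * ∑ q ∈ (hbl_shell_heights_finite hN hy η).toFinset with y q = η, Θ q := by
        rw [Finset.mul_sum]
        exact Finset.sum_congr rfl fun q _ => hΘS q
    _ = 0 := by rw [hfibΘ η, mul_zero]

end Peel

/-- **Shell peeling: an identically vanishing mode sum has vanishing shell sums of fibres.** See
the module docstring; the profiles are written inline (`if k = k₀ then … else …`). With
`t₀ = X₀`, `T = X₀ + 3`: the zero mode is peeled by `hbl_peel_zeroMode`, the shells by strong
induction on `#{k' | ρ k' < ρ k}` with `hbl_peel_step`. [folklore] -/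
theorem hbl_shellSums_eq_zero_of_modeSum_eq_zero' {K R : Type*} [Countable K] [Countable R]
    [DecidableEq K] (k₀ : K) (ρ : K → ℝ) (hρ0 : ρ k₀ = 0) (hρ : ∀ k, k ≠ k₀ → 0 < ρ k)
    (hfin : ∀ C : ℝ, {k : K | ρ k ≤ C}.Finite)
    (hexp : ∀ ε : ℝ, 0 < ε → Summable fun k : K => Real.exp (-(ε * ρ k)))
    (ψ : K → ℂ) (hψ : ∀ k, ‖ψ k‖ = 1)
    (θ : K → R → ℂ) (hθ : ∀ k q, ‖θ k q‖ ≤ 1)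
    (y : R → ℝ) (hy : ∀ q, 0 ≤ y q) {N : ℕ}
    (hN : ∀ j : ℕ, {q : R | (j : ℝ) ≤ y q ∧ y q ≤ j + 1}.encard ≤ N)
    (ν₁ ν₂ c₀ : ℝ) (a b : ℝ → ℝ) (ha : ∀ r, 0 < r → a r ≠ 0) {A : ℝ}
    (hab : ∀ r, 0 < r → |a r| ≤ A * Real.exp r ∧ |b r| ≤ A * Real.exp r)
    {X₀ : ℝ} (hX₀ : 0 < X₀)
    (hsum : ∀ X : ℝ, X₀ < X → HasSum (fun k : K => ψ k *
      ∑' q : R, θ k q *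
        (if k = k₀ then
          ((c₀ * (-(Real.pi * ((X + y q)⁻¹ ^ 5 / 3 - (X + y q)⁻¹ ^ 11 / 6))) : ℝ) : ℂ)
        else
          ((a (ρ k) * (((X + y q) ^ (-(2 : ℝ)) : ℝ) *
                ∫ u : ℝ, Real.exp (ν₁ * u - 2 * Real.pi * ρ k * (X + y q) * Real.cosh u)) +
            b (ρ k) * (((X + y q) ^ (-(5 : ℝ)) : ℝ) *
                ∫ u : ℝ, Real.exp (ν₂ * u - 2 * Real.pi * ρ k * (X + y q) * Real.cosh u)) :
            ℝ) : ℂ))) 0) :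
    (c₀ ≠ 0 → ∀ η : ℝ,
      ∑ q ∈ (hbl_shell_heights_finite hN hy η).toFinset with y q = η, θ k₀ q = 0) ∧
    ∀ (k : K), k ≠ k₀ → ∀ (η : ℝ),
      ∑ k' ∈ (hfin (ρ k)).toFinset with ρ k' = ρ k,
        ψ k' * ∑ q ∈ (hbl_shell_heights_finite hN hy η).toFinset with y q = η, θ k' q = 0 := by
  -- the modes, the shift `t₀ = X₀` and the threshold `T = X₀ + 3`
  set M : K → ℝ → ℂ := fun k X => ∑' q : R, θ k q *
    (if k = k₀ then
      ((c₀ * (-(Real.pi * ((X + y q)⁻¹ ^ 5 / 3 - (X + y q)⁻¹ ^ 11 / 6))) : ℝ) : ℂ)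
    else
      ((a (ρ k) * (((X + y q) ^ (-(2 : ℝ)) : ℝ) *
            ∫ u : ℝ, Real.exp (ν₁ * u - 2 * Real.pi * ρ k * (X + y q) * Real.cosh u)) +
        b (ρ k) * (((X + y q) ^ (-(5 : ℝ)) : ℝ) *
            ∫ u : ℝ, Real.exp (ν₂ * u - 2 * Real.pi * ρ k * (X + y q) * Real.cosh u)) :
        ℝ) : ℂ)) with hMdef
  have hM : ∀ (k : K) (X : ℝ), M k X = _ := fun k X => rfl
  have hT : X₀ + 3 ≤ X₀ + 3 := le_rfl
  have hM0 : ∀ X : ℝ, X₀ + 3 ≤ X → HasSum (fun k : K => ψ k * M k X) 0 := fun X hX =>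
    hsum X (by linarith)
  obtain ⟨hzero, hZ⟩ := hbl_peel_zeroMode (c₀ := c₀) (ν₁ := ν₁) (ν₂ := ν₂) hρ0 hρ hfin hexp hψ
    hθ hy hN hab hX₀ hT hM hM0
  refine ⟨hzero, ?_⟩
  -- strong induction on the number of frequencies of smaller radius
  suffices key : ∀ (n : ℕ) (k : K),
      ((hfin (ρ k)).toFinset.filter fun k' => ρ k' < ρ k).card = n → k ≠ k₀ → ∀ η : ℝ,
        ∑ k' ∈ (hfin (ρ k)).toFinset with ρ k' = ρ k,
          ψ k' * ∑ q ∈ (hbl_shell_heights_finite hN hy η).toFinset with y q = η, θ k' q = 0 from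
    fun k hk η => key _ k rfl hk η
  intro n
  induction n using Nat.strong_induction_on with
  | _ n ihn =>
    intro k hcard hk η
    refine hbl_peel_step hρ0 hρ hfin hexp hψ hθ hy hN ha hab hX₀ hT hM hM0 hZ hk
      (fun k' hk' hlt η' => ihn _ ?_ k' rfl hk' η') η
    rw [← hcard]
    refine Finset.card_lt_card (Finset.ssubset_iff_of_subset (fun k'' hk'' => ?_) |>.2
      ⟨k', ?_, ?_⟩)
    · have h1 : ρ k'' ≤ ρ k' := (hfin _).mem_toFinset.1 (Finset.mem_filter.1 hk'').1
      have h2 : ρ k'' < ρ k' := (Finset.mem_filter.1 hk'').2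
      exact Finset.mem_filter.2 ⟨(hfin _).mem_toFinset.2 (h1.trans hlt.le), h2.trans hlt⟩
    · exact Finset.mem_filter.2 ⟨(hfin _).mem_toFinset.2 hlt.le, hlt⟩
    · exact fun h => lt_irrefl _ (Finset.mem_filter.1 h).2

/-- **Shell peeling** (registered `∀`-form of `hbl_shellSums_eq_zero_of_modeSum_eq_zero'`,
`K R : Type`). [folklore] -/
theorem hbl_shellSums_eq_zero_of_modeSum_eq_zero : ∀ {K R : Type} [Countable K] [Countable R] [DecidableEq K] (k₀ : K) (ρ : K → ℝ), ρ k₀ = 0 → (∀ k, k ≠ k₀ → 0 < ρ k) → ∀ (hfin : ∀ C : ℝ, {k : K | ρ k ≤ C}.Finite), (∀ ε : ℝ, 0 < ε → Summable fun k : K => Real.exp (-(ε * ρ k))) → ∀ (ψ : K → ℂ), (∀ k, ‖ψ k‖ = 1) → ∀ (θ : K → R → ℂ), (∀ k q, ‖θ k q‖ ≤ 1) → ∀ (y : R → ℝ) (hy : ∀ q, 0 ≤ y q) {N : ℕ} (hN : ∀ j : ℕ, {q : R | (j : ℝ) ≤ y q ∧ y q ≤ j + 1}.encard ≤ N) (ν₁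 ν₂ c₀ : ℝ) (a b : ℝ → ℝ), (∀ r, 0 < r → a r ≠ 0) → ∀ {A : ℝ}, (∀ r, 0 < r → |a r| ≤ A * Real.exp r ∧ |b r| ≤ A * Real.exp r) → ∀ {X₀ : ℝ}, 0 < X₀ → (∀ X : ℝ, X₀ < X → HasSum (fun k : K => ψ k * ∑' q : R, θ k q * (if k = k₀ then ((c₀ * (-(Real.pi * ((X + y q)⁻¹ ^ 5 / 3 - (X + y q)⁻¹ ^ 11 / 6))) : ℝ) : ℂ) else ((a (ρ k) * (((X + y q) ^ (-(2 : ℝ)) : ℝ) * ∫ u : ℝ, Real.exp (ν₁ * u - 2 * Real.pi * ρ k * (X + y q) * Real.cosh u)) + b (ρ k) * (((X + y q) ^ (-(5 : ℝ)) : ℝ) * ∫ u : ℝ, Real.exp (ν₂ * u - 2 * Real.pi * ρ k * (X + y q) * Real.cosh u)) : ℝ) : ℂ))) 0) → (c₀ ≠ 0 → ∀ η : ℝ, ∑ q ∈ (Summit.AtomisticToContinuum.Crystallization.Theorems.HolmgrenBoyleLind.hbl_shell_heights_finite hN hy η).toFinset with y q = η, θ k₀ q = 0) ∧ ∀ (k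 : K), k ≠ k₀ → ∀ (η : ℝ), ∑ k' ∈ (hfin (ρ k)).toFinset with ρ k' = ρ k, ψ k' * ∑ q ∈ (Summit.AtomisticToContinuum.Crystallization.Theorems.HolmgrenBoyleLind.hbl_shell_heights_finite hN hy η).toFinset with y q = η, θ k' q = 0 := by
  intro K R _ _ _ k₀ ρ hρ0 hρ hfin hexp ψ hψ θ hθ y hy N hN ν₁ ν₂ c₀ a b ha A hab X₀ hX₀ hsum
  exact hbl_shellSums_eq_zero_of_modeSum_eq_zero' k₀ ρ hρ0 hρ hfin hexp ψ hψ θ hθ y hy hN ν₁ ν₂ c₀ a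
    b ha hab hX₀ hsum

end Summit.AtomisticToContinuum.Crystallization.Theorems.HolmgrenBoyleLind

end
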